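import Literature.Geometry.GeometricMeasureTheory.CurrentsVariationMeasure
import Mathlib.Analysis.Calculus.BumpFunction.SmoothApprox
import Mathlib.MeasureTheory.Integral.Layercake

/-!
# `T(φ) ≤ ∫ ‖φ‖ d‖T‖`: currents of locally finite mass are dominated by their variation measure

Federer 4.1.5: a current `T` with `‖T‖` a Radon measure is "representable by integration",
`T(φ) = ∫ ⟨φ(x), T⃗(x)⟩ d‖T‖ x`, in particular **`T(φ) ≤ ∫ ‖φ‖ d‖T‖`**. This file proves the
inequality for the currents of `Currents.lean` and the variation measure `Current.variation` of
`CurrentsVariationMeasure.lean`: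

* `Current.ofReal_apply_le_lintegral` — `T(φ) ≤ ∫ ‖φ‖ d‖T‖` whenever `spt φ` lies in an open set
  `V` with `‖T‖(V) < ∞`; `Current.abs_apply_le_lintegral` — `|T(φ)| ≤ ∫ ‖φ‖ d‖T‖`;
  `Current.ofReal_apply_le_lintegral_of_mass_ne_top` — the case `𝐌(T) < ∞`.

The hypothesis `‖T‖(V) < ∞` cannot be dropped (for the `0`-current `δ'₀` on `ℝ` and `φ` with
`φ(0) = 0`, `φ'(0) = 1` one has `T(φ) = 1` but `∫ |φ| d‖T‖ = ∞ · 0 = 0`).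

## Proof

Since `T` is only defined on smooth forms, the classical layer decomposition is carried out with
continuous pieces which are then mollified (`exists_contDiff_approx_tsupport_subset`, from
Mathlib's `Continuous.exists_contDiff_dist_le_of_forall_mem_ball_dist_le`, with support control):
with `g = ‖φ‖ ≤ M`, `δ = M/N` and the bands `band δ i s = min (max (s − iδ) 0) δ` (which add up to
`min s (Nδ)`, `sum_band_eq`), `φ = Σ_{i<N} ψᵢ + e` where `ψᵢ = band δ i (g) · φ / max(g, δ)` has
norm `≤ δ` and support in `{g ≥ iδ} ⊆ {g > (i−1)δ}`, and `‖e‖ ≤ δ`. Each piece contributes at most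
`(δ + ε') ‖T‖(its open set)` (`Current.abs_apply_le_mul_variation`), and the lower Riemann sum
`Σ δ ‖T‖{g > jδ}` is below `∫ g d‖T‖` by the layer-cake formula
(`sum_mul_measure_lt_le_lintegral`); this gives `T(φ) ≤ I (1 + 1/(N+1)) + 7 (M/N) ‖T‖(V)`
(`Current.apply_le_lintegral_core`) and `N → ∞` concludes.

## References

* H. Federer, *Geometric Measure Theory*, Springer 1969, 4.1.5 [Federer1969].
-/

noncomputable section

open scoped Distributions ENNReal NNReal Topology ContDiff
open MeasureTheory TopologicalSpace Set Filter Metric Function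

namespace Literature.Geometry.GeometricMeasureTheory

set_option maxSynthPendingDepth 3

/-! ### Smooth approximation with support control; Riemann sums and the layer-cake formula -/


section Approx

variable {E F : Type*} [NormedAddCommGroup E] [NormedSpace ℝ E] [FiniteDimensional ℝ E]
  [NormedAddCommGroup F] [NormedSpace ℝ F] [CompleteSpace F]

/-- **Uniform approximation of continuous compactly supported maps by smooth ones, with support
control**: for `ψ` continuous with compact support inside an open `V` and `ε > 0` there is a smooth
`g` with compact support inside `V` and `‖g − ψ‖ ≤ ε` everywhere (mollification; Mathlib's
`Continuous.exists_contDiff_dist_le_of_forall_mem_ball_dist_le`). [folklore] -/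
theorem exists_contDiff_approx_tsupport_subset {ψ : E → F} (hψ : Continuous ψ)
    (hc : HasCompactSupport ψ) {V : Set E} (hV : IsOpen V) (hψV : tsupport ψ ⊆ V) {ε : ℝ}
    (hε : 0 < ε) :
    ∃ g : E → F, ContDiff ℝ ∞ g ∧ HasCompactSupport g ∧ tsupport g ⊆ V ∧ ∀ x, ‖g x - ψ x‖ ≤ ε := by
  -- room around the support, and a modulus of uniform continuity
  obtain ⟨r, hr, hrV⟩ := hc.isCompact.exists_cthickening_subset_open hV hψV
  have huc : UniformContinuous ψ := hc.uniformContinuous_of_continuous hψ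
  obtain ⟨δ₁, hδ₁, hψδ⟩ := Metric.uniformContinuous_iff.1 huc ε hε
  set ρ : ℝ := min δ₁ r with hρ
  have hρpos : 0 < ρ := lt_min hδ₁ hr
  obtain ⟨g, hg, hgapprox⟩ := hψ.exists_contDiff_dist_le_of_forall_mem_ball_dist_le hρpos
  have hdist : ∀ a, dist (g a) (ψ a) ≤ ε := fun a =>
    hgapprox a ε fun x hx => (hψδ (lt_of_lt_of_le (mem_ball.1 hx) (min_le_left _ _))).le
  -- support control: where `ψ` vanishes on a `ρ`-ball, so does `g`
  have hsupp : support g ⊆ thickening ρ (tsupport ψ) := by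
    intro a ha
    by_contra hat
    have hzero : ∀ x ∈ ball a ρ, ψ x = 0 := by
      intro x hx
      refine image_eq_zero_of_notMem_tsupport fun hxψ => hat ?_
      exact mem_thickening_iff.2 ⟨x, hxψ, by rw [dist_comm]; exact mem_ball.1 hx⟩
    have ha0 : ψ a = 0 := hzero a (mem_ball_self hρpos)
    have := hgapprox a 0 fun x hx => by rw [hzero x hx, ha0, dist_self]
    rw [ha0, dist_le_zero] at this
    exact ha this
  have htsupp : tsupport g ⊆ cthickening ρ (tsupport ψ) :=
    closure_minimal (hsupp.trans (thickening_subset_cthickening _ _)) isClosed_cthickening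
  refine ⟨g, hg, ?_, ?_, fun x => ?_⟩
  · exact (hc.isCompact.cthickening (r := ρ)).of_isClosed_subset (isClosed_tsupport _) htsupp
  · exact htsupp.trans ((cthickening_mono (min_le_right _ _) _).trans hrV)
  · rw [← dist_eq_norm]; exact hdist x

end Approx

section LayerCake

variable {α : Type*} [MeasurableSpace α]

/-- **Lower Riemann sums of the distribution function are below the integral** (layer cake):
`Σ_{i<K} δ · μ{(i+1)δ < g} ≤ ∫ g dμ` for `g ≥ 0`. [folklore] -/
theorem sum_mul_measure_lt_le_lintegral (μ : Measure α) {g : α → ℝ} (hg : AEMeasurable g μ)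
    (hg0 : ∀ x, 0 ≤ g x) {δ : ℝ} (hδ : 0 < δ) (K : ℕ) :
    ∑ i ∈ Finset.range K, ENNReal.ofReal δ * μ {x | ((i : ℝ) + 1) * δ < g x} ≤
      ∫⁻ x, ENNReal.ofReal (g x) ∂μ := by
  rw [lintegral_eq_lintegral_meas_lt μ (Eventually.of_forall hg0) hg]
  have hstep : ∀ i : ℕ, ENNReal.ofReal δ * μ {x | ((i : ℝ) + 1) * δ < g x} ≤
      ∫⁻ t in Ioc ((i : ℝ) * δ) (((i : ℝ) + 1) * δ), μ {x | t < g x} := by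
    intro i
    have hvol : volume (Ioc ((i : ℝ) * δ) (((i : ℝ) + 1) * δ)) = ENNReal.ofReal δ := by
      rw [Real.volume_Ioc]; congr 1; ring
    calc ENNReal.ofReal δ * μ {x | ((i : ℝ) + 1) * δ < g x}
        = ∫⁻ _ in Ioc ((i : ℝ) * δ) (((i : ℝ) + 1) * δ), μ {x | ((i : ℝ) + 1) * δ < g x} := by
          rw [setLIntegral_const, hvol, mul_comm]
      _ ≤ ∫⁻ t in Ioc ((i : ℝ) * δ) (((i : ℝ) + 1) * δ), μ {x | t < g x} := by
          refine setLIntegral_mono' measurableSet_Ioc fun t ht => measure_mono fun x hx => ?_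
          exact lt_of_le_of_lt ht.2 hx
  have hunion : ∀ K : ℕ, ∑ i ∈ Finset.range K,
      ∫⁻ t in Ioc ((i : ℝ) * δ) (((i : ℝ) + 1) * δ), μ {x | t < g x} =
        ∫⁻ t in Ioc 0 ((K : ℝ) * δ), μ {x | t < g x} := by
    intro K
    induction K with
    | zero => simp
    | succ K ih =>
      rw [Finset.sum_range_succ, ih, ← lintegral_union measurableSet_Ioc]
      · congr 1
        rw [Ioc_union_Ioc_eq_Ioc (by positivity) (by nlinarith)]
        push_cast
        ring_nf
      · exact disjoint_left.2 fun t h1 h2 => (not_lt.2 h1.2) h2.1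
  calc ∑ i ∈ Finset.range K, ENNReal.ofReal δ * μ {x | ((i : ℝ) + 1) * δ < g x}
      ≤ ∑ i ∈ Finset.range K, ∫⁻ t in Ioc ((i : ℝ) * δ) (((i : ℝ) + 1) * δ), μ {x | t < g x} :=
        Finset.sum_le_sum fun i _ => hstep i
    _ = ∫⁻ t in Ioc 0 ((K : ℝ) * δ), μ {x | t < g x} := hunion K
    _ ≤ ∫⁻ t in Ioi 0, μ {x | t < g x} := lintegral_mono_set Ioc_subset_Ioi_self

end LayerCake


/-! ### The band functions of the layer decomposition -/

section Band

/-- The `i`-th band of height `δ`: `band δ i s = min (max (s - i δ) 0) δ`, the part of `s` lying in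
the window `[i δ, (i+1) δ]`. [folklore] -/
def band (δ : ℝ) (i : ℕ) (s : ℝ) : ℝ := min (max (s - i * δ) 0) δ

/-- `0 ≤ band δ i s` for `δ ≥ 0`. [folklore] -/
theorem band_nonneg {δ : ℝ} (hδ : 0 ≤ δ) (i : ℕ) (s : ℝ) : 0 ≤ band δ i s :=
  le_min (le_max_right _ _) hδ

/-- `band δ i s ≤ δ`. [folklore] -/
theorem band_le {δ : ℝ} (i : ℕ) (s : ℝ) : band δ i s ≤ δ := min_le_right _ _

/-- The `i`-th band vanishes below `i δ`. [folklore] -/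
theorem band_eq_zero_of_le {δ : ℝ} (hδ : 0 ≤ δ) {i : ℕ} {s : ℝ} (h : s ≤ i * δ) : band δ i s = 0 := by
  unfold band
  rw [max_eq_right (by linarith), min_eq_left hδ]

/-- A nonzero `i`-th band forces `s > i δ`. [folklore] -/
theorem lt_of_band_ne_zero {δ : ℝ} (hδ : 0 ≤ δ) {i : ℕ} {s : ℝ} (h : band δ i s ≠ 0) :
    (i : ℝ) * δ < s := by
  by_contra h'
  exact h (band_eq_zero_of_le hδ (not_lt.1 h'))

/-- `band δ i` is continuous. [folklore] -/
theorem continuous_band (δ : ℝ) (i : ℕ) : Continuous (band δ i) := by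
  unfold band; fun_prop

/-- `band δ i s = min s ((i+1)δ) - min s (iδ)` for `s ≥ 0`, `δ ≥ 0`. [folklore] -/
theorem band_eq_min_sub_min {δ : ℝ} (hδ : 0 ≤ δ) (i : ℕ) (s : ℝ) :
    band δ i s = min s ((i + 1 : ℕ) * δ) - min s (i * δ) := by
  unfold band
  have hi : (0 : ℝ) ≤ i * δ := by positivity
  push_cast
  rcases le_total s (i * δ) with h1 | h1
  · rw [max_eq_right (by linarith), min_eq_left hδ, min_eq_left (by nlinarith), min_eq_left h1,
      sub_self]
  · rw [max_eq_left (by linarith), min_eq_right h1]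
    rcases le_total s ((i + 1) * δ) with h2 | h2
    · rw [min_eq_left (by linarith), min_eq_left h2]
    · rw [min_eq_right (by linarith), min_eq_right h2]; ring

/-- **The bands add up**: `Σ_{i<N} band δ i s = min s (N δ)` for `s, δ ≥ 0`. [folklore] -/
theorem sum_band_eq {δ : ℝ} (hδ : 0 ≤ δ) (N : ℕ) {s : ℝ} (hs : 0 ≤ s) :
    ∑ i ∈ Finset.range N, band δ i s = min s (N * δ) := by
  simp_rw [band_eq_min_sub_min hδ _ s]
  rw [Finset.sum_range_sub (fun i => min s (i * δ)) N]
  simp only [Nat.cast_zero, zero_mul, min_eq_right hs, sub_zero]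

end Band

/-! ### `T(φ) ≤ ∫ ‖φ‖ d‖T‖` -/

section IntegralBound

variable {E : Type*} [NormedAddCommGroup E] [NormedSpace ℝ E] [FiniteDimensional ℝ E]
  [MeasurableSpace E] [BorelSpace E] {Ω : Opens E} {m : ℕ}

/-- **`|T(ψ)| ≤ c · ‖T‖(U)`** for a test form with `‖ψ‖ ≤ c` supported in the open set `U`
(of finite `‖T‖`-measure). [cite: Federer1969, 4.1.5] -/
theorem Current.abs_apply_le_mul_variation (T : Current Ω m) {ψ : TestForm Ω m} {c : ℝ}
    (hc : 0 ≤ c) (hψ : ∀ x, ‖ψ x‖ ≤ c) {U : Set E} (hU : IsOpen U) (hψU : tsupport ⇑ψ ⊆ U)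
    (hfin : T.variation U ≠ ⊤) : |T ψ| ≤ c * (T.variation U).toReal := by
  rcases hc.eq_or_lt with rfl | hcpos
  · have : ψ = 0 := TestFunction.ext fun x => norm_le_zero_iff.1 (hψ x)
    rw [this, map_zero, abs_zero, zero_mul]
  have key : ∀ χ : TestForm Ω m, (∀ x, ‖χ x‖ ≤ c) → tsupport ⇑χ ⊆ U →
      T χ ≤ c * (T.variation U).toReal := by
    intro χ hχ hχU
    have h1 : ∀ x, ‖(c⁻¹ • χ) x‖ ≤ 1 := fun x => by
      rw [show (c⁻¹ • χ) x = c⁻¹ • χ x from rfl, norm_smul, norm_inv, Real.norm_of_nonneg hcpos.le]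
      exact (inv_mul_le_iff₀ hcpos).2 (by simpa using hχ x)
    have h2 : tsupport ⇑(c⁻¹ • χ) ⊆ U :=
      (tsupport_smul_subset_right (fun _ : E => c⁻¹) ⇑χ).trans hχU
    have h3 := T.ofReal_apply_le_variationOn h1 h2
    rw [← T.variation_apply_of_isOpen hU] at h3
    have h4 : T (c⁻¹ • χ) ≤ (T.variation U).toReal := (ENNReal.ofReal_le_iff_le_toReal hfin).1 h3
    rw [map_smul, smul_eq_mul] at h4
    rwa [inv_mul_le_iff₀ hcpos] at h4
  refine abs_le.2 ⟨?_, key ψ hψ hψU⟩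
  have := key (-ψ) (fun x => by simpa using hψ x)
    (by rw [show ⇑(-ψ) = -⇑ψ from rfl, tsupport_neg]; exact hψU)
  rw [map_neg] at this
  linarith

/-- The core estimate behind `T(φ) ≤ ∫ ‖φ‖ d‖T‖`: for every `N ≥ 2`,
`T(φ) ≤ I + I/(N+1) + 7 (M/N) ‖T‖(V)` where `I = ∫ ‖φ‖ d‖T‖`, `‖φ‖ ≤ M`, `spt φ ⊆ V`
(layer decomposition of `φ` into `N` bands of height `M/N` plus a remainder, each mollified).
[cite: Federer1969, 4.1.5] -/
theorem Current.apply_le_lintegral_core (T : Current Ω m) (φ : TestForm Ω m) {V : Set E}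
    (hV : IsOpen V) (hφV : tsupport ⇑φ ⊆ V) (hfin : T.variation V ≠ ⊤) {M : ℝ} (hM : 0 < M)
    (hφM : ∀ x, ‖φ x‖ ≤ M) (hI : ∫⁻ x, ‖φ x‖ₑ ∂T.variation ≠ ⊤) {N : ℕ} (hN : 2 ≤ N) :
    T φ ≤ (∫⁻ x, ‖φ x‖ₑ ∂T.variation).toReal * (1 + 1 / (N + 1)) +
      7 * (M / N) * (T.variation V).toReal := by
  -- notation
  set A : ℝ := (T.variation V).toReal with hA
  set I : ℝ := (∫⁻ x, ‖φ x‖ₑ ∂T.variation).toReal with hIdef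
  have hA0 : 0 ≤ A := ENNReal.toReal_nonneg
  have hI0 : 0 ≤ I := ENNReal.toReal_nonneg
  have hNpos : (0 : ℝ) < N := by exact_mod_cast (lt_of_lt_of_le (by norm_num) hN)
  set δ : ℝ := M / N with hδ
  have hδpos : 0 < δ := div_pos hM hNpos
  have hNδ : (N : ℝ) * δ = M := by rw [hδ]; field_simp
  set ε' : ℝ := δ / (N + 1) with hε'
  have hε'pos : 0 < ε' := div_pos hδpos (by positivity)
  have hε'le : ε' ≤ δ := div_le_self hδpos.le (by linarith)
  -- the norm function and the open sets
  set g : E → ℝ := fun x => ‖φ x‖ with hg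
  have hgc : Continuous g := φ.continuous.norm
  have hg0 : ∀ x, 0 ≤ g x := fun x => norm_nonneg _
  have hVΩ : tsupport ⇑φ ⊆ V ∩ (Ω : Set E) := subset_inter hφV φ.tsupport_subset
  have hOV : IsOpen (V ∩ (Ω : Set E)) := hV.inter Ω.isOpen
  set W : ℕ → Set E := fun i => {x | ((i : ℝ) - 1) * δ < g x} with hW
  have hWo : ∀ i, IsOpen (W i) := fun i => isOpen_lt continuous_const hgc
  -- the continuous pieces
  set u : E → Covector E m := fun x => (max (g x) δ)⁻¹ • φ x with hu
  have hmaxpos : ∀ x, 0 < max (g x) δ := fun x => lt_max_of_lt_right hδpos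
  have huc : Continuous u :=
    ((hgc.max continuous_const).inv₀ fun x => (hmaxpos x).ne').smul φ.continuous
  have hu1 : ∀ x, ‖u x‖ ≤ 1 := fun x => by
    rw [hu, norm_smul, norm_inv, Real.norm_of_nonneg (hmaxpos x).le, inv_mul_le_iff₀ (hmaxpos x),
      mul_one]
    exact le_max_left _ _
  set ψ : ℕ → E → Covector E m := fun i x => band δ i (g x) • u x with hψ
  have hψc : ∀ i, Continuous (ψ i) := fun i => ((continuous_band δ i).comp hgc).smul huc
  have hψδ : ∀ i x, ‖ψ i x‖ ≤ δ := fun i x => by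
    rw [hψ, norm_smul, Real.norm_of_nonneg (band_nonneg hδpos.le _ _)]
    exact (mul_le_of_le_one_right (band_nonneg hδpos.le _ _) (hu1 x)).trans (band_le _ _)
  have hψsupp : ∀ i, Function.support (ψ i) ⊆ Function.support ⇑φ ∩ {x | (i : ℝ) * δ < g x} := by
    intro i x hx
    rw [Function.mem_support, hψ] at hx
    refine ⟨fun h0 => hx ?_, lt_of_band_ne_zero hδpos.le (left_ne_zero_of_smul hx)⟩
    simp only [hu, h0, smul_zero]
  have hψts : ∀ i, tsupport (ψ i) ⊆ tsupport ⇑φ ∩ {x | (i : ℝ) * δ ≤ g x} := fun i =>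
    closure_minimal ((hψsupp i).trans (inter_subset_inter subset_closure fun x hx =>
        le_of_lt (mem_setOf.1 hx)))
      ((isClosed_tsupport _).inter (isClosed_le continuous_const hgc))
  have hψW : ∀ i, tsupport (ψ i) ⊆ W i ∩ (V ∩ (Ω : Set E)) := by
    intro i x hx
    obtain ⟨h1, h2⟩ := hψts i hx
    refine ⟨?_, hVΩ h1⟩
    change ((i : ℝ) - 1) * δ < g x
    nlinarith [mem_setOf.1 h2]
  have hψcs : ∀ i, HasCompactSupport (ψ i) := fun i =>
    φ.hasCompactSupport.mono ((hψsupp i).trans inter_subset_left)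
  set e : E → Covector E m := fun x => φ x - ∑ i ∈ Finset.range N, ψ i x with he
  have hec : Continuous e := φ.continuous.sub (continuous_finsetSum _ fun i _ => hψc i)
  have hesupp : Function.support e ⊆ Function.support ⇑φ := by
    intro x hx
    rw [Function.mem_support] at hx ⊢
    intro h0
    refine hx ?_
    simp only [he, hψ, hu, h0, smul_zero, Finset.sum_const_zero, sub_zero]
  have hecs : HasCompactSupport e := φ.hasCompactSupport.mono hesupp
  have hets : tsupport e ⊆ V ∩ (Ω : Set E) := (closure_mono hesupp).trans hVΩ
  have heδ : ∀ x, ‖e x‖ ≤ δ := by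
    intro x
    have hsum : ∑ i ∈ Finset.range N, ψ i x = g x • u x := by
      simp only [hψ]
      rw [← Finset.sum_smul, sum_band_eq hδpos.le N (hg0 x), hNδ, min_eq_left (hφM x)]
    have hex : e x = (1 - g x * (max (g x) δ)⁻¹) • φ x := by
      simp only [he, hsum, hu, smul_smul, sub_smul, one_smul]
    rw [hex, norm_smul]
    change ‖1 - g x * (max (g x) δ)⁻¹‖ * g x ≤ δ
    rcases le_or_gt (g x) δ with h | h
    · have h1 : 0 ≤ 1 - g x * (max (g x) δ)⁻¹ := by
        rw [sub_nonneg]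
        exact (mul_inv_le_iff₀ (hmaxpos x)).2 (by rw [one_mul]; exact le_max_left _ _)
      have h2 : 1 - g x * (max (g x) δ)⁻¹ ≤ 1 := by
        have : 0 ≤ g x * (max (g x) δ)⁻¹ := mul_nonneg (hg0 x) (inv_nonneg.2 (hmaxpos x).le)
        linarith
      rw [Real.norm_of_nonneg h1]
      calc (1 - g x * (max (g x) δ)⁻¹) * g x ≤ 1 * g x :=
            mul_le_mul_of_nonneg_right h2 (hg0 x)
        _ ≤ δ := by rw [one_mul]; exact h
    · rw [max_eq_left h.le, mul_inv_cancel₀ (hδpos.trans h).ne', sub_self, norm_zero, zero_mul]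
      exact hδpos.le
  -- mollify the pieces
  have hmoll : ∀ i, ∃ Ψ : TestForm Ω m, tsupport ⇑Ψ ⊆ W i ∩ (V ∩ (Ω : Set E)) ∧
      ∀ x, ‖Ψ x - ψ i x‖ ≤ ε' := by
    intro i
    obtain ⟨q, hq, hqc, hqs, hqa⟩ := exists_contDiff_approx_tsupport_subset (hψc i) (hψcs i)
      ((hWo i).inter hOV) (hψW i) hε'pos
    exact ⟨⟨q, hq, hqc, hqs.trans (inter_subset_right.trans inter_subset_right)⟩, hqs, hqa⟩
  choose Ψ hΨs hΨa using hmoll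
  obtain ⟨q, hq, hqc, hqs, hqa⟩ := exists_contDiff_approx_tsupport_subset hec hecs hOV hets hε'pos
  set Ε : TestForm Ω m := ⟨q, hq, hqc, hqs.trans inter_subset_right⟩ with hΕ
  -- the smooth approximant of `φ`
  set Φ' : TestForm Ω m := ∑ i ∈ Finset.range N, Ψ i + Ε with hΦ'
  have hdiff : ∀ x, ‖(φ - Φ') x‖ ≤ δ := by
    intro x
    have hx : (φ - Φ') x = (e x - q x) + ∑ i ∈ Finset.range N, (ψ i x - Ψ i x) := by
      rw [sub_apply, hΦ', add_apply, sum_apply, Finset.sum_sub_distrib]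
      change φ x - (∑ i ∈ Finset.range N, Ψ i x + q x) =
        (φ x - ∑ i ∈ Finset.range N, ψ i x) - q x +
          (∑ i ∈ Finset.range N, ψ i x - ∑ i ∈ Finset.range N, Ψ i x)
      abel
    rw [hx]
    calc ‖(e x - q x) + ∑ i ∈ Finset.range N, (ψ i x - Ψ i x)‖
        ≤ ‖e x - q x‖ + ∑ i ∈ Finset.range N, ‖ψ i x - Ψ i x‖ :=
          (norm_add_le _ _).trans (add_le_add le_rfl (norm_sum_le _ _))
      _ ≤ ε' + ∑ _i ∈ Finset.range N, ε' :=
          add_le_add (by rw [norm_sub_rev]; exact hqa x)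
            (Finset.sum_le_sum fun i _ => by rw [norm_sub_rev]; exact hΨa i x)
      _ = (N + 1) * ε' := by rw [Finset.sum_const, Finset.card_range, nsmul_eq_mul]; ring
      _ = δ := by rw [hε']; field_simp
  -- supports: everything lives in `V`
  have hΦ's : tsupport ⇑Φ' ⊆ V := by
    have hcl : IsClosed ((⋃ i ∈ Finset.range N, tsupport ⇑(Ψ i)) ∪ tsupport q) :=
      ((Finset.range N).finite_toSet.isClosed_biUnion fun i _ => isClosed_tsupport _).union
        (isClosed_tsupport _)
    refine (closure_minimal (fun x hx => ?_) hcl).trans ?_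
    · rw [Function.mem_support] at hx
      by_contra hx'
      simp only [mem_union, mem_iUnion, not_or, not_exists] at hx'
      apply hx
      rw [hΦ', add_apply, sum_apply]
      change ∑ i ∈ Finset.range N, Ψ i x + q x = 0
      rw [image_eq_zero_of_notMem_tsupport hx'.2, add_zero]
      exact Finset.sum_eq_zero fun i hi => image_eq_zero_of_notMem_tsupport (hx'.1 i hi)
    · refine union_subset (iUnion₂_subset fun i _ => (hΨs i).trans ?_) (hqs.trans inter_subset_left)
      exact inter_subset_right.trans inter_subset_left
  have hds : tsupport ⇑(φ - Φ') ⊆ V := by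
    refine closure_minimal ?_ ((isClosed_tsupport ⇑φ).union (isClosed_tsupport ⇑Φ')) |>.trans
      (union_subset hφV hΦ's)
    intro x hx
    rw [Function.mem_support] at hx
    by_contra h
    simp only [mem_union, not_or] at h
    apply hx
    rw [sub_apply, image_eq_zero_of_notMem_tsupport h.1, image_eq_zero_of_notMem_tsupport h.2,
      sub_zero]
  -- `T φ = Σ T Ψᵢ + T Ε + T (φ - Φ')`
  have hsplit : T φ = ∑ i ∈ Finset.range N, T (Ψ i) + T Ε + T (φ - Φ') := by
    rw [map_sub, hΦ', map_add, map_sum]; ring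
  -- bounds on the pieces
  have hfinW : ∀ i, T.variation (W i ∩ (V ∩ (Ω : Set E))) ≠ ⊤ := fun i =>
    ne_top_of_le_ne_top hfin (measure_mono (inter_subset_right.trans inter_subset_left))
  have hWA : ∀ i, (T.variation (W i ∩ (V ∩ (Ω : Set E)))).toReal ≤ A := fun i =>
    ENNReal.toReal_mono hfin (measure_mono (inter_subset_right.trans inter_subset_left))
  have hΨb : ∀ i, T (Ψ i) ≤ (δ + ε') * (T.variation (W i ∩ (V ∩ (Ω : Set E)))).toReal := by
    intro i
    refine (le_abs_self _).trans (T.abs_apply_le_mul_variation (by positivity) (fun x => ?_)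
      ((hWo i).inter hOV) (hΨs i) (hfinW i))
    calc ‖Ψ i x‖ = ‖ψ i x + (Ψ i x - ψ i x)‖ := by rw [add_sub_cancel]
      _ ≤ ‖ψ i x‖ + ‖Ψ i x - ψ i x‖ := norm_add_le _ _
      _ ≤ δ + ε' := add_le_add (hψδ i x) (hΨa i x)
  have hEb : T Ε ≤ (δ + ε') * A := by
    refine (le_abs_self _).trans (T.abs_apply_le_mul_variation (by positivity) (fun x => ?_)
      hV (hqs.trans inter_subset_left) hfin)
    change ‖q x‖ ≤ δ + ε'
    calc ‖q x‖ = ‖e x + (q x - e x)‖ := by rw [add_sub_cancel]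
      _ ≤ ‖e x‖ + ‖q x - e x‖ := norm_add_le _ _
      _ ≤ δ + ε' := add_le_add (heδ x) (hqa x)
  have hRb : T (φ - Φ') ≤ δ * A :=
    (le_abs_self _).trans (T.abs_apply_le_mul_variation hδpos.le hdiff hV hds hfin)
  -- the layer-cake estimate for the bands `i ≥ 2`
  have hμfin : ∀ j : ℕ, T.variation {x | ((j : ℝ) + 1) * δ < g x} ≠ ⊤ := by
    intro j
    refine ne_top_of_le_ne_top hfin (measure_mono fun x hx => hφV (subset_tsupport _ ?_))
    rw [Function.mem_support]
    intro h0
    have : ((j : ℝ) + 1) * δ < 0 := by simpa [hg, h0] using hx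
    nlinarith
  have hcake : ∑ j ∈ Finset.range (N - 2), δ * (T.variation {x | ((j : ℝ) + 1) * δ < g x}).toReal
      ≤ I := by
    have h1 := sum_mul_measure_lt_le_lintegral T.variation
      φ.continuous.norm.aemeasurable hg0 hδpos (N - 2)
    have h2 : ∫⁻ x, ENNReal.ofReal (g x) ∂T.variation = ∫⁻ x, ‖φ x‖ₑ ∂T.variation :=
      lintegral_congr fun x => ofReal_norm (φ x)
    rw [h2] at h1
    have h3 := ENNReal.toReal_mono hI h1
    rw [ENNReal.toReal_sum (fun j _ => ENNReal.mul_ne_top ENNReal.ofReal_ne_top (hμfin j))] at h3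
    refine le_trans (le_of_eq (Finset.sum_congr rfl fun j _ => ?_)) h3
    rw [ENNReal.toReal_mul, ENNReal.toReal_ofReal hδpos.le]
  -- sum over the bands
  have hsum : ∑ i ∈ Finset.range N, T (Ψ i) ≤ 2 * ((δ + ε') * A) + (1 + ε' / δ) * I := by
    rw [← Finset.sum_range_add_sum_Ico _ hN, Finset.sum_Ico_eq_sum_range]
    refine add_le_add ?_ ?_
    · rw [Finset.sum_range_succ, Finset.sum_range_one, two_mul]
      exact add_le_add ((hΨb 0).trans (mul_le_mul_of_nonneg_left (hWA 0) (by positivity)))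
        ((hΨb 1).trans (mul_le_mul_of_nonneg_left (hWA 1) (by positivity)))
    · calc ∑ k ∈ Finset.range (N - 2), T (Ψ (2 + k))
          ≤ ∑ k ∈ Finset.range (N - 2),
              (δ + ε') * (T.variation {x | ((k : ℝ) + 1) * δ < g x}).toReal := by
            refine Finset.sum_le_sum fun k _ => (hΨb (2 + k)).trans
              (mul_le_mul_of_nonneg_left (ENNReal.toReal_mono (hμfin k)
                (measure_mono (inter_subset_left.trans fun x hx => ?_))) (by positivity))
            have hx' : ((↑(2 + k) : ℝ) - 1) * δ < g x := hx
            push_cast at hx'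
            change ((k : ℝ) + 1) * δ < g x
            linarith
        _ = (1 + ε' / δ) *
              ∑ k ∈ Finset.range (N - 2), δ * (T.variation {x | ((k : ℝ) + 1) * δ < g x}).toReal := by
            rw [Finset.mul_sum]
            refine Finset.sum_congr rfl fun k _ => ?_
            field_simp
        _ ≤ (1 + ε' / δ) * I := mul_le_mul_of_nonneg_left hcake (by positivity)
  -- assemble
  have hε'δ : ε' / δ = 1 / (N + 1) := by
    rw [hε']; field_simp
  rw [hsplit]
  calc ∑ i ∈ Finset.range N, T (Ψ i) + T Ε + T (φ - Φ')
      ≤ (2 * ((δ + ε') * A) + (1 + ε' / δ) * I) + (δ + ε') * A + δ * A :=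
        add_le_add (add_le_add hsum hEb) hRb
    _ = I * (1 + 1 / (N + 1)) + (4 * δ + 3 * ε') * A := by rw [hε'δ]; ring
    _ ≤ I * (1 + 1 / (N + 1)) + 7 * δ * A := by
        have : (4 * δ + 3 * ε') * A ≤ 7 * δ * A :=
          mul_le_mul_of_nonneg_right (by linarith) hA0
        linarith

/-- **`T(φ) ≤ ∫ ‖φ‖ d‖T‖`** for a test form supported in an open set of finite `‖T‖`-measure
(Federer 4.1.5: currents of locally finite mass are "representable by integration",
`T(φ) = ∫ ⟨φ, T⃗⟩ d‖T‖ ≤ ∫ ‖φ‖ d‖T‖`). [cite: Federer1969, 4.1.5] -/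
theorem Current.ofReal_apply_le_lintegral (T : Current Ω m) (φ : TestForm Ω m) {V : Set E}
    (hV : IsOpen V) (hφV : tsupport ⇑φ ⊆ V) (hfin : T.variation V ≠ ⊤) :
    ENNReal.ofReal (T φ) ≤ ∫⁻ x, ‖φ x‖ₑ ∂T.variation := by
  by_cases hI : ∫⁻ x, ‖φ x‖ₑ ∂T.variation = ⊤
  · rw [hI]; exact le_top
  obtain ⟨M, hM, hφM⟩ := TestForm.exists_pos_forall_norm_le φ
  set I : ℝ := (∫⁻ x, ‖φ x‖ₑ ∂T.variation).toReal with hIdef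
  set A : ℝ := (T.variation V).toReal with hA
  have hI0 : 0 ≤ I := ENNReal.toReal_nonneg
  have hA0 : 0 ≤ A := ENNReal.toReal_nonneg
  have key : T φ ≤ I := by
    refine le_of_forall_pos_lt_add fun η hη => ?_
    obtain ⟨N, hN⟩ := exists_nat_gt (max 2 ((I + 7 * M * A) / η))
    have hN2 : 2 ≤ N := by exact_mod_cast ((le_max_left _ _).trans hN.le)
    have hNpos : (0 : ℝ) < N := by exact_mod_cast lt_of_lt_of_le (by norm_num) hN2
    have hcore := T.apply_le_lintegral_core φ hV hφV hfin hM hφM hI hN2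
    have h1 : I * (1 + 1 / (N + 1)) + 7 * (M / N) * A ≤ I + (I + 7 * M * A) / N := by
      have : I / (N + 1) ≤ I / N := div_le_div_of_nonneg_left hI0 hNpos (by linarith)
      calc I * (1 + 1 / (N + 1)) + 7 * (M / N) * A = I + I / (N + 1) + 7 * M * A / N := by ring
        _ ≤ I + I / N + 7 * M * A / N := by linarith
        _ = I + (I + 7 * M * A) / N := by ring
    have h2 : (I + 7 * M * A) / N < η := by
      rw [div_lt_iff₀ hNpos]
      have := (le_max_right _ _).trans_lt hN
      rw [div_lt_iff₀ hη] at this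
      linarith
    linarith
  calc ENNReal.ofReal (T φ) ≤ ENNReal.ofReal I := ENNReal.ofReal_le_ofReal key
    _ = ∫⁻ x, ‖φ x‖ₑ ∂T.variation := ENNReal.ofReal_toReal hI

/-- **`|T(φ)| ≤ ∫ ‖φ‖ d‖T‖`** (apply the previous bound to `±φ`). [cite: Federer1969, 4.1.5] -/
theorem Current.abs_apply_le_lintegral (T : Current Ω m) (φ : TestForm Ω m) {V : Set E}
    (hV : IsOpen V) (hφV : tsupport ⇑φ ⊆ V) (hfin : T.variation V ≠ ⊤)
    (hI : ∫⁻ x, ‖φ x‖ₑ ∂T.variation ≠ ⊤) :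
    |T φ| ≤ (∫⁻ x, ‖φ x‖ₑ ∂T.variation).toReal := by
  refine abs_le.2 ⟨?_, (ENNReal.ofReal_le_iff_le_toReal hI).1
    (T.ofReal_apply_le_lintegral φ hV hφV hfin)⟩
  have h := T.ofReal_apply_le_lintegral (-φ) hV
    (by rw [show ⇑(-φ) = -⇑φ from rfl, tsupport_neg]; exact hφV) hfin
  have h' : ∫⁻ x, ‖(-φ) x‖ₑ ∂T.variation = ∫⁻ x, ‖φ x‖ₑ ∂T.variation :=
    lintegral_congr fun x => by rw [show (-φ) x = -φ x from rfl, enorm_neg]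
  rw [h', map_neg] at h
  have := (ENNReal.ofReal_le_iff_le_toReal hI).1 h
  linarith

/-- **`T(φ) ≤ ∫ ‖φ‖ d‖T‖` for currents of finite mass.** [cite: Federer1969, 4.1.5] -/
theorem Current.ofReal_apply_le_lintegral_of_mass_ne_top (T : Current Ω m) (hT : T.mass ≠ ⊤)
    (φ : TestForm Ω m) : ENNReal.ofReal (T φ) ≤ ∫⁻ x, ‖φ x‖ₑ ∂T.variation :=
  T.ofReal_apply_le_lintegral φ isOpen_univ (subset_univ _) (by rwa [T.variation_univ])

end IntegralBound

end Literature.Geometry.GeometricMeasureTheory
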